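import Summits.AnomalousDissipation.AnomalousDissipation.Theorems.TaylorCertificatesSteadyStatesLoudBoundedSheetDodgerProfile
import Summits.AnomalousDissipation.AnomalousDissipation.Theorems.TaylorCertificatesSteadyStatesLoudBoundedSheetDodgerField
import Literature.Analysis.FunctionSpaces.TorusSobolevL6
import Literature.Analysis.FunctionSpaces.TorusTrilinearH1
import Mathlib.Algebra.QuadraticDiscriminant
import HarnessLib

/-!
# Kolmogorov-mode forces have Onsager dodgers: `NoOnsagerDodger` fails for `sin(2πk x₀) e₂`
# (negative knowledge for the Lamb-floor machinery of crux stmt-AnomalousDissipation-13038)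

The floor lines of the crux bet on `NoOnsagerDodger f E` (bad sequences — admissible `u_n`, `∫|u_n|² ≤ E`,
dual residual bounds `R_n → 0`, vanishing virtual dissipation `R_n‖∇u_n‖₂ → 0` — have non-divergent enstrophy).
Here this is REFUTED for every single Kolmogorov mode `f_k = sin(2πk x₀) e₂` (`k ≥ 1`) by the explicit
vortex-sheet family of `SheetDodgerField` with the square-wave profile of `SheetDodgerProfile`:
`u_n = (P_n(x₁)•(−e₀), P_n(x₁) cos(2πk x₀)/(2πk)) ∘ π`, whose Euler residual is EXACTLY
`(P_n² − 1) sin(2πk x₀) e₂`, supported in layers of volume `≤ 1/(2n)`. The dual-norm bound gains the factor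
`(layer volume)^{3/4}` through a weighted Cauchy–Schwarz inequality, Ladyzhenskaya's `L⁴` inequality and the
Poincaré–Wirtinger inequality, while `gradNormSq u_n ≍ n`. Pure proofs.
-/

noncomputable section

open Set Filter MeasureTheory intervalIntegral Function
open scoped Topology Real ContDiff InnerProductSpace NNReal

-- `Summit.<Summit>.<Problem>` is the tree's mandated summit-side namespace (CONVENTIONS §2); single-conjunct summit, duplicate deliberate.
set_option linter.dupNamespace false

namespace Summit.AnomalousDissipation.AnomalousDissipation.Theorems.SteadyStatesLoudBounded.SheetDodger

open Literature.Analysis.FunctionSpaces Literature.Analysis.FunctionSpaces.Torus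

/-! ## Two Cauchy–Schwarz inequalities for continuous functions on the torus -/

/-- **Weighted Cauchy–Schwarz**: `(∫ a g)² ≤ (∫ a)(∫ a g²)` for a continuous weight `a ≥ 0` and continuous `g`
(the quadratic `t ↦ ∫ a (g − t)² ≥ 0` has non-positive discriminant). -/
theorem sq_integral_weight_mul_le {a g : UnitAddTorus (Fin 3) → ℝ} (ha : Continuous a) (hg : Continuous g)
    (ha0 : ∀ x, 0 ≤ a x) :
    (∫ x, a x * g x) ^ 2 ≤ (∫ x, a x) * ∫ x, a x * g x ^ 2 := by
  have i0 : Integrable a volume := ha.integrable_unitAddTorus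
  have i1 : Integrable (fun x => a x * g x) volume := (ha.mul hg).integrable_unitAddTorus
  have i2 : Integrable (fun x => a x * g x ^ 2) volume := (ha.mul (hg.pow 2)).integrable_unitAddTorus
  have hquad : ∀ t : ℝ, 0 ≤ (∫ x, a x) * (t * t) + (-2 * ∫ x, a x * g x) * t + ∫ x, a x * g x ^ 2 := by
    intro t
    have h0 : 0 ≤ ∫ x, a x * (g x - t) ^ 2 := integral_nonneg fun x => mul_nonneg (ha0 x) (sq_nonneg _)
    have hexp : ∫ x, a x * (g x - t) ^ 2 = (∫ x, a x) * (t * t) + (-2 * ∫ x, a x * g x) * t + ∫ x, a x * g x ^ 2 := by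
      have e : (fun x => a x * (g x - t) ^ 2) = fun x => a x * g x ^ 2 - (2 * t) * (a x * g x) + (t * t) * a x := by
        funext x; ring
      have j1 : Integrable (fun x => a x * g x ^ 2 - (2 * t) * (a x * g x)) volume := i2.sub (i1.const_mul _)
      have j2 : Integrable (fun x => (t * t) * a x) volume := i0.const_mul _
      rw [e, integral_add j1 j2, integral_sub i2 (i1.const_mul _), MeasureTheory.integral_const_mul, MeasureTheory.integral_const_mul]
      ring
    linarith
  have h := discrim_le_zero hquad
  rw [discrim] at h
  nlinarith

/-- **Cauchy–Schwarz**: `(∫ f g)² ≤ (∫ f²)(∫ g²)` for continuous `f, g`. -/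
theorem sq_integral_mul_le {f g : UnitAddTorus (Fin 3) → ℝ} (hf : Continuous f) (hg : Continuous g) :
    (∫ x, f x * g x) ^ 2 ≤ (∫ x, f x ^ 2) * ∫ x, g x ^ 2 := by
  have i0 : Integrable (fun x => f x ^ 2) volume := (hf.pow 2).integrable_unitAddTorus
  have i1 : Integrable (fun x => f x * g x) volume := (hf.mul hg).integrable_unitAddTorus
  have i2 : Integrable (fun x => g x ^ 2) volume := (hg.pow 2).integrable_unitAddTorus
  have hquad : ∀ t : ℝ, 0 ≤ (∫ x, f x ^ 2) * (t * t) + (-2 * ∫ x, f x * g x) * t + ∫ x, g x ^ 2 := by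
    intro t
    have h0 : 0 ≤ ∫ x, (t * f x - g x) ^ 2 := integral_nonneg fun x => sq_nonneg _
    have hexp : ∫ x, (t * f x - g x) ^ 2 = (∫ x, f x ^ 2) * (t * t) + (-2 * ∫ x, f x * g x) * t + ∫ x, g x ^ 2 := by
      have e : (fun x => (t * f x - g x) ^ 2) = fun x => (t * t) * f x ^ 2 - (2 * t) * (f x * g x) + g x ^ 2 := by
        funext x; ring
      have j1 : Integrable (fun x => (t * t) * f x ^ 2 - (2 * t) * (f x * g x)) volume := (i0.const_mul _).sub (i1.const_mul _)
      rw [e, integral_add j1 i2, integral_sub (i0.const_mul _) (i1.const_mul _), MeasureTheory.integral_const_mul, MeasureTheory.integral_const_mul]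
      ring
    linarith
  have h := discrim_le_zero hquad
  rw [discrim] at h
  nlinarith

/-! ## The layer gain: `∫ a‖w‖ ≲ (∫ a)^{3/4} ‖∇w‖₂` for weights `0 ≤ a ≤ 1` and zero-mean test fields -/

/-- **Weighted pairing estimate.** There is `L` such that for every smooth zero-mean `w : T³ → ℝ³` and every
continuous weight `0 ≤ a ≤ 1`: `∫ a‖w‖ ≤ L · (√A · √√A) · √(gradNormSq w)`, `A = ∫ a` — i.e.
`∫ a‖w‖ ≤ L A^{3/4} ‖∇w‖₂` (weighted Cauchy–Schwarz twice, Ladyzhenskaya `L⁴`, Poincaré–Wirtinger and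
`∫‖Dw‖² ≤ 3·gradNormSq w`). -/
theorem exists_weighted_pairing_const : ∃ L : ℝ, 0 ≤ L ∧
    ∀ (w : UnitAddTorus (Fin 3) → EuclideanSpace ℝ (Fin 3)) (a : UnitAddTorus (Fin 3) → ℝ),
      Torus.IsSmooth w → Torus.HasZeroMean w → Continuous a → (∀ x, 0 ≤ a x) → (∀ x, a x ≤ 1) →
      ∫ x, a x * ‖w x‖ ≤ L * (Real.sqrt (∫ x, a x) * Real.sqrt (Real.sqrt (∫ x, a x))) * Real.sqrt (Torus.gradNormSq w) := by
  obtain ⟨K, hK⟩ := Torus.integral_norm_pow_four_le_of_hasZeroMean (d := Fin 3) (F' := EuclideanSpace ℝ (Fin 3)) (by simp)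
  refine ⟨Real.sqrt (Real.sqrt (729 * K)), Real.sqrt_nonneg _, fun w a hw h0 ha ha0 ha1 => ?_⟩
  set A : ℝ := ∫ x, a x with hA
  set G : ℝ := Torus.gradNormSq w with hG
  have hwc : Continuous w := hw.continuous
  have hA0 : 0 ≤ A := integral_nonneg ha0
  have hG0 : 0 ≤ G := Torus.gradNormSq_nonneg w
  -- `∫ ‖w‖⁴ ≤ 729 K G²`
  have h2 : ∫ x, ‖w x‖ ^ 2 ≤ 27 * G := by
    have h := Torus.integral_norm_sq_le_card_pow_mul_gradNormSq hw h0
    norm_num at h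
    exact h
  have hD : ∫ x, ‖Torus.fderiv w x‖ ^ 2 ≤ 27 * G := by
    have h := Torus.integral_norm_fderiv_sq_le_card_mul_gradNormSq hw
    norm_num at h
    linarith
  have hQ : ∫ x, ‖w x‖ ^ 4 ≤ 729 * K * G ^ 2 := by
    have h := hK w hw h0
    have e1 : (∫ x, ‖w x‖ ^ 2) ^ (1 / 2 : ℝ) ≤ (27 * G) ^ (1 / 2 : ℝ) :=
      Real.rpow_le_rpow (integral_nonneg fun x => sq_nonneg _) h2 (by norm_num)
    have e2 : (∫ x, ‖Torus.fderiv w x‖ ^ 2) ^ (3 / 2 : ℝ) ≤ (27 * G) ^ (3 / 2 : ℝ) :=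
      Real.rpow_le_rpow (integral_nonneg fun x => sq_nonneg _) hD (by norm_num)
    have e3 : (27 * G) ^ (1 / 2 : ℝ) * (27 * G) ^ (3 / 2 : ℝ) = (27 * G) ^ 2 := by
      rw [← Real.rpow_add' (by positivity) (by norm_num)]
      norm_num
    calc ∫ x, ‖w x‖ ^ 4 ≤ K * (∫ x, ‖w x‖ ^ 2) ^ (1 / 2 : ℝ) * (∫ x, ‖Torus.fderiv w x‖ ^ 2) ^ (3 / 2 : ℝ) := h
      _ ≤ K * (27 * G) ^ (1 / 2 : ℝ) * (27 * G) ^ (3 / 2 : ℝ) := by gcongr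
      _ = 729 * K * G ^ 2 := by rw [mul_assoc, e3]; ring
  -- two Cauchy–Schwarz steps
  have hI1 : (∫ x, a x * ‖w x‖) ^ 2 ≤ A * ∫ x, a x * ‖w x‖ ^ 2 := sq_integral_weight_mul_le ha hwc.norm ha0
  have hI2 : (∫ x, a x * ‖w x‖ ^ 2) ^ 2 ≤ A * ∫ x, ‖w x‖ ^ 4 := by
    have h := sq_integral_mul_le ha (g := fun x => ‖w x‖ ^ 2) (hwc.norm.pow 2)
    have haa : ∫ x, a x ^ 2 ≤ A := integral_mono (ha.pow 2).integrable_unitAddTorus ha.integrable_unitAddTorus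
      fun x => by nlinarith [ha0 x, ha1 x]
    have h4 : ∫ x, (‖w x‖ ^ 2) ^ 2 = ∫ x, ‖w x‖ ^ 4 := integral_congr_ae (ae_of_all _ fun x => by ring)
    rw [h4] at h
    exact h.trans (mul_le_mul_of_nonneg_right haa (integral_nonneg fun x => by positivity))
  have hI10 : 0 ≤ ∫ x, a x * ‖w x‖ := integral_nonneg fun x => mul_nonneg (ha0 x) (norm_nonneg _)
  have hI20 : 0 ≤ ∫ x, a x * ‖w x‖ ^ 2 := integral_nonneg fun x => mul_nonneg (ha0 x) (sq_nonneg _)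
  -- `(∫ a‖w‖)⁴ ≤ A³ · 729K · G²`
  have h4 : (∫ x, a x * ‖w x‖) ^ 4 ≤ A ^ 3 * (729 * K * G ^ 2) := by
    calc (∫ x, a x * ‖w x‖) ^ 4 = ((∫ x, a x * ‖w x‖) ^ 2) ^ 2 := by ring
      _ ≤ (A * ∫ x, a x * ‖w x‖ ^ 2) ^ 2 := pow_le_pow_left₀ (sq_nonneg _) hI1 2
      _ = A ^ 2 * (∫ x, a x * ‖w x‖ ^ 2) ^ 2 := by ring
      _ ≤ A ^ 2 * (A * ∫ x, ‖w x‖ ^ 4) := mul_le_mul_of_nonneg_left hI2 (sq_nonneg _)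
      _ ≤ A ^ 2 * (A * (729 * K * G ^ 2)) := by gcongr
      _ = A ^ 3 * (729 * K * G ^ 2) := by ring
  -- fourth roots
  have hK0 : 0 ≤ (729 : ℝ) * K := by positivity
  set y : ℝ := Real.sqrt (Real.sqrt (729 * K)) * (Real.sqrt A * Real.sqrt (Real.sqrt A)) * Real.sqrt G with hy
  have hy0 : 0 ≤ y := by positivity
  have hy4 : y ^ 4 = A ^ 3 * (729 * K * G ^ 2) := by
    have s1 : Real.sqrt (Real.sqrt (729 * K)) ^ 4 = 729 * K := by
      rw [show (4 : ℕ) = 2 * 2 from rfl, pow_mul, Real.sq_sqrt (Real.sqrt_nonneg _), Real.sq_sqrt hK0]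
    have s2 : Real.sqrt A ^ 4 = A ^ 2 := by
      rw [show (4 : ℕ) = 2 * 2 from rfl, pow_mul, Real.sq_sqrt hA0]
    have s3 : Real.sqrt (Real.sqrt A) ^ 4 = A := by
      rw [show (4 : ℕ) = 2 * 2 from rfl, pow_mul, Real.sq_sqrt (Real.sqrt_nonneg _), Real.sq_sqrt hA0]
    have s4 : Real.sqrt G ^ 4 = G ^ 2 := by
      rw [show (4 : ℕ) = 2 * 2 from rfl, pow_mul, Real.sq_sqrt hG0]
    rw [hy, mul_pow, mul_pow, mul_pow, s1, s2, s3, s4]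
    ring
  rw [← hy4] at h4
  exact le_of_pow_le_pow_left₀ (by norm_num) hy0 h4


/-! ## The Kolmogorov mode `sin(2πk x₀) e₂` and its sheet dodgers -/

/-- The imaginary part of the `k`-th character of the unit circle: `Im e_k(s) = sin(2πks)`. -/
theorem im_fourier_coe (k : ℕ) (s : ℝ) : ((@fourier 1 (k : ℤ)) ((s : ℝ) : UnitAddCircle) : ℂ).im = Real.sin (2 * π * k * s) := by
  rw [fourier_coe_apply]
  simp [Complex.exp_im, Complex.mul_re, Complex.mul_im, Complex.I_re, Complex.I_im]

/-- `|Im e_k(b)| ≤ 1` on the circle. -/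
theorem abs_im_fourier_le (k : ℕ) (b : UnitAddCircle) : |((@fourier 1 (k : ℤ)) b : ℂ).im| ≤ 1 := by
  induction b using QuotientAddGroup.induction_on with
  | H s => rw [im_fourier_coe]; exact Real.abs_sin_le_one _

/-- The derivative of the cosine profile `cos(2πκt)/(2πκ)` is `−sin(2πκt)` (`κ ≠ 0`). -/
theorem hasDerivAt_cosProfile {κ : ℝ} (hκ : κ ≠ 0) (t : ℝ) :
    HasDerivAt (fun t : ℝ => Real.cos (2 * π * κ * t) / (2 * π * κ)) (-Real.sin (2 * π * κ * t)) t := by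
  have h2 : (2 * π * κ) ≠ 0 := mul_ne_zero (mul_ne_zero two_ne_zero Real.pi_ne_zero) hκ
  have h := ((Real.hasDerivAt_cos (2 * π * κ * t)).comp t ((hasDerivAt_id t).const_mul (2 * π * κ))).div_const (2 * π * κ)
  refine (h.congr_deriv ?_)
  field_simp

/-- **Registered negative-knowledge stub `stub_kolmogorovModeOnsagerDodger`** (crux stmt-AnomalousDissipation-13038,
line `lamb-floor-f123-shared-ceiling`): for every Kolmogorov mode `f_k = sin(2πk x₀) e₂` (`k ≥ 1`, written as the
`2½`-dimensional vertical force `(0, 0, Im e_k(x₀)) ∘ π`), the statement `NoOnsagerDodger f_k E` — the floor bet of the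
Lamb-rigidity machinery (S2–S4b of line `lojasiewicz-lamb-floor-ladder`, re-used by this line) — is FALSE at the level
`E = 2`: there is a bad sequence `u_n` (smooth, divergence free, mean zero, `∫|u_n|² ≤ 2`, residual bounds `R_n → 0`,
`R_n‖∇u_n‖₂ → 0`) with `‖∇u_n‖₂ → ∞`. The sequence is the explicit vortex-sheet family
`u_n = (P_{n+1}(x₁)(−e₀), P_{n+1}(x₁) cos(2πk x₀)/(2πk)) ∘ π`, whose residual is exactly `(P_{n+1}² − 1) f_k`. -/
theorem stub_kolmogorovModeOnsagerDodger : ∀ k : ℕ, 1 ≤ k →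
    ∃ (E : ℝ) (u : ℕ → UnitAddTorus (Fin 3) → EuclideanSpace ℝ (Fin 3)) (R : ℕ → ℝ),
      (∀ n : ℕ, Literature.Analysis.FunctionSpaces.Torus.IsSmooth (u n) ∧
        Literature.Analysis.FunctionSpaces.Torus.IsDivFree (u n) ∧
        Literature.Analysis.FunctionSpaces.Torus.HasZeroMean (u n) ∧
        ∫ x, ‖u n x‖ ^ 2 ≤ E ∧ 0 ≤ R n ∧
        ∀ w : UnitAddTorus (Fin 3) → EuclideanSpace ℝ (Fin 3),
          Literature.Analysis.FunctionSpaces.Torus.IsSmooth w → Literature.Analysis.FunctionSpaces.Torus.IsDivFree w →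
          Literature.Analysis.FunctionSpaces.Torus.HasZeroMean w →
          |∫ x, inner ℝ (Literature.Analysis.FunctionSpaces.Torus.convect (u n) (u n) x -
              Literature.Analysis.FunctionSpaces.Torus.twoHalf 0
                (fun y : UnitAddTorus (Fin 2) => (((@fourier 1 (k : ℤ)) (y 0) : ℂ)).im) x) (w x)| ≤
            R n * Real.sqrt (Literature.Analysis.FunctionSpaces.Torus.gradNormSq w)) ∧
      Filter.Tendsto R Filter.atTop (nhds 0) ∧
      Filter.Tendsto (fun n => R n * Real.sqrt (Literature.Analysis.FunctionSpaces.Torus.gradNormSq (u n))) Filter.atTop (nhds 0) ∧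
      ∀ B : ℝ, ∃ N : ℕ, ∀ n : ℕ, N ≤ n → B < Literature.Analysis.FunctionSpaces.Torus.gradNormSq (u n) := by
  intro k hk
  obtain ⟨L, hL0, hL⟩ := exists_weighted_pairing_const
  obtain ⟨hsm, hper, hhalf, habs, hsq, hder, hI1, hI3, D, hD0, hDb, hI2⟩ := stub_sheetDodgerProfileTools
  have hκ : (1 : ℝ) ≤ k := by exact_mod_cast hk
  have hκ0 : (k : ℝ) ≠ 0 := by positivity
  have h2πκ : (0 : ℝ) < 2 * π * k := by positivity
  -- the profiles as `ShearProfile`s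
  let Sp : ℕ → ShearProfile := fun n =>
    ⟨fun t : ℝ => Real.smoothTransition (((n : ℝ) + 1) * Real.sin (2 * π * t) + 2⁻¹) -
        Real.smoothTransition (2⁻¹ - ((n : ℝ) + 1) * Real.sin (2 * π * t)),
      fun t => hper _ t, hsm _⟩
  have hGper : Function.Periodic (fun t : ℝ => Real.cos (2 * π * k * t) / (2 * π * k)) 1 := by
    intro t
    show Real.cos (2 * π * k * (t + 1)) / (2 * π * k) = Real.cos (2 * π * k * t) / (2 * π * k)
    rw [show 2 * π * k * (t + 1) = 2 * π * k * t + k * (2 * π) by ring, Real.cos_add_nat_mul_two_pi]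
  let G : ShearProfile := ⟨fun t : ℝ => Real.cos (2 * π * k * t) / (2 * π * k), hGper,
    (Real.contDiff_cos.comp (contDiff_const.mul contDiff_id)).div_const _⟩
  have hGD : ∀ t, deriv G t = -Real.sin (2 * π * k * t) := fun t => (hasDerivAt_cosProfile hκ0 t).deriv
  have hGb : ∀ t, |G t| ≤ 1 := by
    intro t
    change |Real.cos (2 * π * k * t) / (2 * π * k)| ≤ 1
    rw [abs_div, abs_of_pos h2πκ, div_le_one h2πκ]
    have := Real.abs_cos_le_one (2 * π * k * t)
    nlinarith [Real.pi_gt_three, hκ]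
  have hGDb : ∀ t, |deriv G t| ≤ 1 := fun t => by rw [hGD, abs_neg]; exact Real.abs_sin_le_one _
  have hSb : ∀ n t, |Sp n t| ≤ 1 := fun n t => habs _ t
  -- `G'` on the circle is `−Im e_k`
  have hGDcirc : ∀ b : UnitAddCircle, G.D.onCircle b = -((@fourier 1 (k : ℤ)) b : ℂ).im := by
    intro b
    induction b using QuotientAddGroup.induction_on with
    | H s => rw [ShearProfile.onCircle_coe, ShearProfile.D_apply, hGD, im_fourier_coe]
  -- the fields and the residual bounds
  let u : ℕ → UnitAddTorus (Fin 3) → EuclideanSpace ℝ (Fin 3) := fun n =>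
    twoHalf (fun y : UnitAddTorus (Fin 2) => (Sp n).onCircle (y 1) • ((-(1 : ℝ)) • EuclideanSpace.single (0 : Fin 2) (1 : ℝ)))
      (fun y : UnitAddTorus (Fin 2) => (Sp n).onCircle (y 1) * G.onCircle (y 0))
  let α : ℕ → ℝ := fun n => 1 / (2 * ((n : ℝ) + 1))
  let R : ℕ → ℝ := fun n => L * (Real.sqrt (α n) * Real.sqrt (Real.sqrt (α n)))
  have hα0 : ∀ n, 0 < α n := fun n => by positivity
  -- facts about each member
  have hmem : ∀ n, Torus.IsSmooth (u n) ∧ Torus.IsDivFree (u n) ∧ Torus.HasZeroMean (u n) ∧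
      (∫ x, ‖u n x‖ ^ 2 ≤ 2) ∧
      (8 * ((n : ℝ) + 1) ≤ Torus.gradNormSq (u n) ∧ Torus.gradNormSq (u n) ≤ (4 * π ^ 2 * D ^ 2 + 1) * ((n : ℝ) + 1)) ∧
      ∀ w : UnitAddTorus (Fin 3) → EuclideanSpace ℝ (Fin 3), Torus.IsSmooth w → Torus.IsDivFree w → Torus.HasZeroMean w →
        |∫ x, inner ℝ (Torus.convect (u n) (u n) x -
            twoHalf 0 (fun y : UnitAddTorus (Fin 2) => (((@fourier 1 (k : ℤ)) (y 0) : ℂ)).im) x) (w x)| ≤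
          R n * Real.sqrt (Torus.gradNormSq w) := by
    intro n
    obtain ⟨hs, hdiv, hconv, hzero, henergy, hgrad⟩ := stub_sheetDodgerFieldTools (Sp n) G 1 (u n) rfl
    have hn1 : (1 : ℝ) ≤ (n : ℝ) + 1 := by simp
    -- the period integral of `S'²`
    have hderiv : ∀ t, deriv (Sp n) t = (deriv Real.smoothTransition (((n : ℝ) + 1) * Real.sin (2 * π * t) + 2⁻¹) +
        deriv Real.smoothTransition (2⁻¹ - ((n : ℝ) + 1) * Real.sin (2 * π * t))) * (((n : ℝ) + 1) * (2 * π * Real.cos (2 * π * t))) :=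
      fun t => (hder _ t).deriv
    have hIS : ∫ t in (0 : ℝ)..1, deriv (Sp n).toFun t ^ 2 = ∫ t in (0 : ℝ)..1, ((deriv Real.smoothTransition (((n : ℝ) + 1) * Real.sin (2 * π * t) + 2⁻¹) +
        deriv Real.smoothTransition (2⁻¹ - ((n : ℝ) + 1) * Real.sin (2 * π * t))) * (((n : ℝ) + 1) * (2 * π * Real.cos (2 * π * t)))) ^ 2 :=
      intervalIntegral.integral_congr fun t _ => by rw [← hderiv t]
    have hG8 : 8 * ((n : ℝ) + 1) ≤ ∫ t in (0 : ℝ)..1, deriv (Sp n).toFun t ^ 2 := by rw [hIS]; exact hI3 _ hn1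
    have hGup : ∫ t in (0 : ℝ)..1, deriv (Sp n).toFun t ^ 2 ≤ 2 * π ^ 2 * D ^ 2 * ((n : ℝ) + 1) := by rw [hIS]; exact hI2 _ hn1
    obtain ⟨hg1, hg2⟩ := hgrad 1 1 (hSb n) hGb hGDb
    refine ⟨hs, hdiv, hzero (fun t => hhalf _ t), ?_, ⟨?_, ?_⟩, ?_⟩
    · have := henergy 1 (hSb n) hGb; norm_num at this ⊢; linarith
    · linarith
    · nlinarith [Real.pi_pos, sq_nonneg D, sq_nonneg π]
    · intro w hw _ hw0
      -- the residual is `((S² − 1) Im e_k) e₂ ∘ π`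
      have hres : ∀ x, Torus.convect (u n) (u n) x - twoHalf 0 (fun y : UnitAddTorus (Fin 2) => (((@fourier 1 (k : ℤ)) (y 0) : ℂ)).im) x =
          twoHalf 0 (fun y : UnitAddTorus (Fin 2) => ((Sp n).onCircle (y 1) ^ 2 - 1) * (((@fourier 1 (k : ℤ)) (y 0) : ℂ)).im) x := by
        intro x
        rw [hconv, ← Pi.sub_apply, ← twoHalf_sub, sub_zero]
        congr 2
        funext y
        simp only [Pi.sub_apply]
        rw [hGDcirc]
        ring
      have hinner : ∀ x, inner ℝ (Torus.convect (u n) (u n) x - twoHalf 0 (fun y : UnitAddTorus (Fin 2) => (((@fourier 1 (k : ℤ)) (y 0) : ℂ)).im) x) (w x) =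
          (((Sp n).onCircle (x 1) ^ 2 - 1) * (((@fourier 1 (k : ℤ)) (x 0) : ℂ)).im) * w x 2 := by
        intro x
        rw [hres x]
        simp only [twoHalf]
        rw [inner_planarEmbed_left]
        simp [planarProj_apply]
      simp_rw [hinner]
      -- pointwise bound by the weight `a = 1 − S(x₁)²` times `‖w‖`
      set a : UnitAddTorus (Fin 3) → ℝ := fun x => 1 - (Sp n).onCircle (x 1) ^ 2 with ha_def
      have ha0 : ∀ x, 0 ≤ a x := fun x => by
        simp only [ha_def]
        induction x 1 using QuotientAddGroup.induction_on with
        | H s => rw [ShearProfile.onCircle_coe]; exact (hsq ((n : ℝ) + 1) s).1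
      have ha1 : ∀ x, a x ≤ 1 := fun x => by
        simp only [ha_def]
        induction x 1 using QuotientAddGroup.induction_on with
        | H s => rw [ShearProfile.onCircle_coe]; exact (hsq ((n : ℝ) + 1) s).2
      have hac : Continuous a := by
        have c1 : Continuous (fun x : UnitAddTorus (Fin 3) => (Sp n).onCircle (x 1)) := (Sp n).continuous_onCircle.comp (continuous_apply 1)
        exact continuous_const.sub (c1.pow 2)
      have hpt : ∀ x, |(((Sp n).onCircle (x 1) ^ 2 - 1) * (((@fourier 1 (k : ℤ)) (x 0) : ℂ)).im) * w x 2| ≤ a x * ‖w x‖ := by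
        intro x
        rw [abs_mul, abs_mul]
        have h1 : |(Sp n).onCircle (x 1) ^ 2 - 1| = a x := by
          rw [abs_sub_comm, abs_of_nonneg (ha0 x)]
        have h2 : |(((@fourier 1 (k : ℤ)) (x 0) : ℂ)).im| ≤ 1 := abs_im_fourier_le _ _
        have h3 : |w x 2| ≤ ‖w x‖ := by
          have := PiLp.norm_apply_le (w x) 2
          rwa [Real.norm_eq_abs] at this
        rw [h1]
        calc a x * |(((@fourier 1 (k : ℤ)) (x 0) : ℂ)).im| * |w x 2| ≤ a x * 1 * ‖w x‖ :=
              mul_le_mul (mul_le_mul_of_nonneg_left h2 (ha0 x)) h3 (abs_nonneg _) (by rw [mul_one]; exact ha0 x)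
          _ = a x * ‖w x‖ := by ring
      have hcont : Continuous fun x => (((Sp n).onCircle (x 1) ^ 2 - 1) * (((@fourier 1 (k : ℤ)) (x 0) : ℂ)).im) * w x 2 := by
        have c1 : Continuous fun x : UnitAddTorus (Fin 3) => (Sp n).onCircle (x 1) := (Sp n).continuous_onCircle.comp (continuous_apply 1)
        have c2 : Continuous fun x : UnitAddTorus (Fin 3) => (((@fourier 1 (k : ℤ)) (x 0) : ℂ)).im :=
          Complex.continuous_im.comp ((@fourier 1 (k : ℤ)).continuous.comp (continuous_apply 0))
        have c3 : Continuous fun x : UnitAddTorus (Fin 3) => w x 2 :=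
          (EuclideanSpace.proj (2 : Fin 3)).continuous.comp hw.continuous
        exact (((c1.pow 2).sub continuous_const).mul c2).mul c3
      have hbound : |∫ x, (((Sp n).onCircle (x 1) ^ 2 - 1) * (((@fourier 1 (k : ℤ)) (x 0) : ℂ)).im) * w x 2| ≤ ∫ x, a x * ‖w x‖ :=
        (MeasureTheory.abs_integral_le_integral_abs).trans (integral_mono hcont.abs.integrable_unitAddTorus
          (hac.mul hw.continuous.norm).integrable_unitAddTorus hpt)
      have hpair := hL w a hw hw0 hac ha0 ha1
      -- the layer volume
      have hA : ∫ x, a x ≤ α n := by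
        have e : ∫ x, a x = ∫ t in (0 : ℝ)..1, (1 - (Sp n) t ^ 2) :=
          integral_onCircle_comp (Sp n) (F := fun r : ℝ => 1 - r ^ 2) (continuous_const.sub (continuous_pow 2)) (1 : Fin 3)
        rw [e]
        exact hI1 ((n : ℝ) + 1) hn1
      have hA0 : 0 ≤ ∫ x, a x := integral_nonneg ha0
      have hmono : Real.sqrt (∫ x, a x) * Real.sqrt (Real.sqrt (∫ x, a x)) ≤ Real.sqrt (α n) * Real.sqrt (Real.sqrt (α n)) :=
        mul_le_mul (Real.sqrt_le_sqrt hA) (Real.sqrt_le_sqrt (Real.sqrt_le_sqrt hA)) (Real.sqrt_nonneg _) (Real.sqrt_nonneg _)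
      calc _ ≤ ∫ x, a x * ‖w x‖ := hbound
        _ ≤ L * (Real.sqrt (∫ x, a x) * Real.sqrt (Real.sqrt (∫ x, a x))) * Real.sqrt (Torus.gradNormSq w) := hpair
        _ ≤ L * (Real.sqrt (α n) * Real.sqrt (Real.sqrt (α n))) * Real.sqrt (Torus.gradNormSq w) := by
            gcongr
  -- assembling
  refine ⟨2, u, R, fun n => ?_, ?_, ?_, ?_⟩
  · obtain ⟨hs, hdiv, hzero, hE, -, hres⟩ := hmem n
    exact ⟨hs, hdiv, hzero, hE, by positivity, hres⟩
  · -- `R n → 0`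
    have hαt : Tendsto α atTop (𝓝 0) := by
      have h : Tendsto (fun n : ℕ => 2 * ((n : ℝ) + 1)) atTop atTop :=
        (tendsto_natCast_atTop_atTop.atTop_add tendsto_const_nhds).const_mul_atTop (by norm_num)
      exact tendsto_const_nhds.div_atTop h
    have hs1 : Tendsto (fun n => Real.sqrt (α n)) atTop (𝓝 0) := by
      have := (Real.continuous_sqrt.tendsto 0).comp hαt
      rwa [Function.comp_def, Real.sqrt_zero] at this
    have hs2 : Tendsto (fun n => Real.sqrt (Real.sqrt (α n))) atTop (𝓝 0) := by
      have := (Real.continuous_sqrt.tendsto 0).comp hs1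
      rwa [Function.comp_def, Real.sqrt_zero] at this
    have := (hs1.mul hs2).const_mul L
    rwa [mul_zero, mul_zero] at this
  · -- `R n ‖∇u_n‖ → 0`: `0 ≤ R n √G_n ≤ L √(C₁/2) · √√(α n)`
    set C₁ : ℝ := 4 * π ^ 2 * D ^ 2 + 1 with hC₁
    have hC₁0 : 0 < C₁ := by positivity
    have hαt : Tendsto α atTop (𝓝 0) := by
      have h : Tendsto (fun n : ℕ => 2 * ((n : ℝ) + 1)) atTop atTop :=
        (tendsto_natCast_atTop_atTop.atTop_add tendsto_const_nhds).const_mul_atTop (by norm_num)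
      exact tendsto_const_nhds.div_atTop h
    have hs2 : Tendsto (fun n => Real.sqrt (Real.sqrt (α n))) atTop (𝓝 0) := by
      have h1 : Tendsto (fun n => Real.sqrt (α n)) atTop (𝓝 0) := by
        have := (Real.continuous_sqrt.tendsto 0).comp hαt
        rwa [Function.comp_def, Real.sqrt_zero] at this
      have := (Real.continuous_sqrt.tendsto 0).comp h1
      rwa [Function.comp_def, Real.sqrt_zero] at this
    have hup : Tendsto (fun n => L * Real.sqrt (C₁ / 2) * Real.sqrt (Real.sqrt (α n))) atTop (𝓝 0) := by
      have := hs2.const_mul (L * Real.sqrt (C₁ / 2))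
      rwa [mul_zero] at this
    refine tendsto_of_tendsto_of_tendsto_of_le_of_le tendsto_const_nhds hup (fun n => ?_) (fun n => ?_)
    · exact mul_nonneg (by positivity) (Real.sqrt_nonneg _)
    · obtain ⟨-, -, -, -, ⟨-, hGup⟩, -⟩ := hmem n
      have hG0 : 0 ≤ Torus.gradNormSq (u n) := Torus.gradNormSq_nonneg _
      have hsG : Real.sqrt (Torus.gradNormSq (u n)) ≤ Real.sqrt (C₁ * ((n : ℝ) + 1)) := Real.sqrt_le_sqrt hGup
      have e : Real.sqrt (α n) * Real.sqrt (C₁ * ((n : ℝ) + 1)) = Real.sqrt (C₁ / 2) := by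
        rw [← Real.sqrt_mul (hα0 n).le]
        congr 1
        simp only [α]
        field_simp
      calc R n * Real.sqrt (Torus.gradNormSq (u n))
          = L * Real.sqrt (Real.sqrt (α n)) * (Real.sqrt (α n) * Real.sqrt (Torus.gradNormSq (u n))) := by simp only [R]; ring
        _ ≤ L * Real.sqrt (Real.sqrt (α n)) * (Real.sqrt (α n) * Real.sqrt (C₁ * ((n : ℝ) + 1))) := by gcongr
        _ = L * Real.sqrt (C₁ / 2) * Real.sqrt (Real.sqrt (α n)) := by rw [e]; ring
  · -- divergent enstrophy
    intro B
    obtain ⟨N, hN⟩ := exists_nat_gt (B / 8)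
    refine ⟨N, fun n hn => ?_⟩
    obtain ⟨-, -, -, -, ⟨hG8, -⟩, -⟩ := hmem n
    have hnR : (N : ℝ) ≤ n := by exact_mod_cast hn
    have : B < 8 * ((n : ℝ) + 1) := by
      rw [div_lt_iff₀ (by norm_num : (0 : ℝ) < 8)] at hN
      linarith
    linarith

end Summit.AnomalousDissipation.AnomalousDissipation.Theorems.SteadyStatesLoudBounded.SheetDodger

end
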